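import Summits.AtomisticToContinuum.HydrodynamicLimit.Theorems.RelayRaceLocalityNearConstantShortTimeHLSmallTiltGronwallDefs
import Summits.AtomisticToContinuum.HydrodynamicLimit.Theorems.SuperextensiveClosureCostBlockEntropyBudgetBallAverages
import HarnessLib

/-!
# Crux `NearConstantShortTimeHL` (stmt-AtomisticToContinuum-12502), line `small-tilt-domination` — the weighted
# Cauchy–Schwarz (Schur) `L²` bound for signed combinations of ball kernels

Support file for the crux `…Theses.RelayRaceLocality.NearConstantShortTimeHL`, line `small-tilt-domination`
(lead c7, wave 1): the registered stub `integral_sq_sum_ballKernel_le`.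

For centres `y j ∈ 𝕋³`, nonnegative weights `b j` and coefficients `λ j`, put `K j = ballKernel ℓ (y j) ·`
(nonnegative, unit mass for `0 < ℓ < 1/2`) and `G = Σ_j b_j λ_j K_j`. If the envelope `Σ_j b_j K_j ≤ A` pointwise,
then `∫ G² ≤ A Σ_j b_j λ_j²`. Proof: pointwise Cauchy–Schwarz with the weights `b_j K_j(x)`,
`G(x)² ≤ (Σ_j b_j K_j(x)) (Σ_j b_j λ_j² K_j(x)) ≤ A Σ_j b_j λ_j² K_j(x)`, then integrate using `∫ K_j = 1`.

References: folklore (Schur test / weighted Cauchy–Schwarz).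
-/

noncomputable section

namespace Summit.AtomisticToContinuum.HydrodynamicLimit.Theorems.NearConstantShortTimeHL

open scoped BigOperators ENNReal
open MeasureTheory Set Filter Topology
open Literature.MathematicalPhysics.KineticTheory Literature.Analysis.FluidPDE Literature.Analysis.FunctionSpaces

/-- The ball kernel is symmetric in its two arguments (the minimal-image distance is symmetric). [folklore] -/
theorem bks_ballKernel_comm (ℓ : ℝ) (x y : T3) : ballKernel ℓ x y = ballKernel ℓ y x := by
  unfold ballKernel
  rw [Torus.euclidDist_comm]

/-- The ball kernel is integrable in its second variable (bounded indicator on the compact torus). [folklore] -/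
theorem bks_integrable_ballKernel_right (ℓ : ℝ) (y : T3) : Integrable fun x : T3 => ballKernel ℓ y x := by
  simp_rw [bks_ballKernel_comm ℓ y]
  exact integrable_ballKernel ℓ _ y

/-- Unit mass of the ball kernel in its second variable: `∫ ballKernel ℓ y x dx = 1` for `0 < ℓ < 1/2`. [folklore] -/
theorem bks_integral_ballKernel_right_eq_one {ℓ : ℝ} (hℓ0 : 0 < ℓ) (hℓ : ℓ < 1 / 2) (y : T3) :
    ∫ x : T3, ballKernel ℓ y x = 1 := by
  simp_rw [bks_ballKernel_comm ℓ y]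
  exact integral_ballKernel_eq_one hℓ0 hℓ y

/-- Pointwise weighted Cauchy–Schwarz: for nonnegative weights `w j` and reals `λ j`,
`(Σ_j w_j λ_j)² ≤ (Σ_j w_j) (Σ_j w_j λ_j²)`. [folklore] -/
theorem bks_sq_sum_mul_le {J : ℕ} (w lam : Fin J → ℝ) (hw : ∀ j, 0 ≤ w j) :
    (∑ j, w j * lam j) ^ 2 ≤ (∑ j, w j) * ∑ j, w j * lam j ^ 2 :=
  Finset.sum_sq_le_sum_mul_sum_of_sq_le_mul Finset.univ (fun j _ => hw j)
    (fun j _ => mul_nonneg (hw j) (sq_nonneg _)) (fun j _ => le_of_eq (by ring))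

/-- **Weighted Cauchy–Schwarz (Schur) `L²` bound for signed combinations of ball kernels.** For `0 < ℓ < 1/2`,
centres `y j`, nonnegative weights `b j`, coefficients `λ j` and a pointwise envelope `Σ_j b_j ballKernel ℓ (y j) x ≤ A`:
`∫ (Σ_j b_j λ_j ballKernel ℓ (y j) x)² dx ≤ A Σ_j b_j λ_j²`. [folklore] -/
theorem integral_sq_sum_ballKernel_le : ∀ {ℓ : ℝ}, 0 < ℓ → ℓ < 1 / 2 → ∀ {J : ℕ} (y : Fin J → T3) (b lam : Fin J → ℝ) {A : ℝ}, (∀ j, 0 ≤ b j) → (∀ x : T3, ∑ j, b j * ballKernel ℓ (y j) x ≤ A) → ∫ x, (∑ j, b j * lam j * ballKernel ℓ (y j) x) ^ 2 ≤ A * ∑ j, b j * lam j ^ 2 := by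
  intro ℓ hℓ0 hℓ J y b lam A hb hA
  -- nonnegativity of the weights `b j * K_j(x)`
  have hw : ∀ (x : T3) (j : Fin J), 0 ≤ b j * ballKernel ℓ (y j) x := fun x j =>
    mul_nonneg (hb j) (ballKernel_nonneg ℓ (y j) x)
  -- the pointwise bound
  have hpt : ∀ x : T3, (∑ j, b j * lam j * ballKernel ℓ (y j) x) ^ 2 ≤
      A * ∑ j, b j * lam j ^ 2 * ballKernel ℓ (y j) x := by
    intro x
    have hCS := bks_sq_sum_mul_le (fun j => b j * ballKernel ℓ (y j) x) lam (hw x)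
    have h1 : ∑ j, b j * ballKernel ℓ (y j) x * lam j = ∑ j, b j * lam j * ballKernel ℓ (y j) x :=
      Finset.sum_congr rfl fun j _ => by ring
    have h2 : ∑ j, b j * ballKernel ℓ (y j) x * lam j ^ 2 = ∑ j, b j * lam j ^ 2 * ballKernel ℓ (y j) x :=
      Finset.sum_congr rfl fun j _ => by ring
    rw [h1, h2] at hCS
    refine hCS.trans (mul_le_mul_of_nonneg_right (hA x) (Finset.sum_nonneg fun j _ => ?_))
    calc (0 : ℝ) ≤ b j * ballKernel ℓ (y j) x * lam j ^ 2 := mul_nonneg (hw x j) (sq_nonneg _)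
      _ = b j * lam j ^ 2 * ballKernel ℓ (y j) x := by ring
  -- integrability of the dominating side
  have hint : Integrable fun x : T3 => A * ∑ j, b j * lam j ^ 2 * ballKernel ℓ (y j) x :=
    (integrable_finsetSum _ fun j _ => (bks_integrable_ballKernel_right ℓ (y j)).const_mul _).const_mul _
  calc ∫ x, (∑ j, b j * lam j * ballKernel ℓ (y j) x) ^ 2
      ≤ ∫ x, A * ∑ j, b j * lam j ^ 2 * ballKernel ℓ (y j) x :=
        integral_mono_of_nonneg (Eventually.of_forall fun x => sq_nonneg _) hint (Eventually.of_forall hpt)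
    _ = A * ∑ j, b j * lam j ^ 2 := by
        rw [integral_const_mul, integral_finsetSum _ fun j _ => (bks_integrable_ballKernel_right ℓ (y j)).const_mul _]
        congr 1
        refine Finset.sum_congr rfl fun j _ => ?_
        rw [integral_const_mul, bks_integral_ballKernel_right_eq_one hℓ0 hℓ (y j), mul_one]

end Summit.AtomisticToContinuum.HydrodynamicLimit.Theorems.NearConstantShortTimeHL

end
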